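import Mathlib
import Summits.ValiantsHypothesis.ValiantsHypothesis.Theses.NewtonUnitEquations
import Summits.ValiantsHypothesis.ValiantsHypothesis.Theorems.NewtonTauWeak.Negative.Zonogon

/-!
# `stub_peelInduction` of line `aligned-peeling` — PROVED (crux-strategist evidence; a prover lands it `--supports 5904`)

`peelInduction : ∀ C c, AlignedPeeling C c → SpsBound (C + 2) (c + 1)`: the induction on the number of factors that spends the
crux's `2^{a m}` budget.  `B 0 = k`, `B (ℓ+1) = C · B ℓ + (k t + 2)^c`; the level-`ℓ` claim is the ALIGNED bound
`AlignedBound g (B ℓ)` for every `t`-sparse family `g : Fin k → Fin ℓ → _` (shifts and scalars are part of the claim, so the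
induction hypothesis is exactly the hypothesis `AlignedPeeling` consumes); the step splits off the last factor
(`Fin.prod_univ_castSucc`) and absorbs `monomial (a i) (d i)` into it.  Finally `B m ≤ (C+1)^m (k + m (kt+2)^c) ≤
2^{(C+2) m}(kt+2)^{c+1}` for `t ≥ 1` (`t = 0`: the sum is a constant).  Sorry-free.

STANDALONE COPY: the three statements `SpsBound`, `AlignedBound`, `AlignedPeeling` and the level-0 lemmas are repeated verbatim
from the skeleton `Cruxes/NewtonTauWeak/Lines/aligned_peeling.lean` (same namespace, same names) so that this file checks
without importing the workfile; a prover landing the stub replaces this block by `import …Lines.aligned_peeling` (or restates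
the stub's signature inline, as the binomial line's stub files do).
-/

set_option linter.dupNamespace false

namespace Summit.ValiantsHypothesis.ValiantsHypothesis.Cruxes.NewtonTauWeak.AlignedPeeling

open scoped BigOperators Pointwise
open MvPolynomial
open Summit.ValiantsHypothesis.ValiantsHypothesis.Theorems.NewtonTauWeak.Negative (vert vert_le_card_support)

noncomputable section

/-! ### Verbatim from the skeleton (see the module docstring) -/

/-- (skeleton) The crux's bound with fixed constants. -/
def SpsBound (a b : ℕ) : Prop :=
  ∀ (k m t : ℕ) (f : Fin k → Fin m → MvPolynomial (Fin 2) ℂ),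
    (∀ i j, (f i j).support.card ≤ t) → vert (∑ i, ∏ j, f i j) ≤ 2 ^ (a * m) * (k * t + 2) ^ b

/-- (skeleton) Aligned-combination bound. -/
def AlignedBound {k ℓ : ℕ} (g : Fin k → Fin ℓ → MvPolynomial (Fin 2) ℂ) (V : ℕ) : Prop :=
  ∀ (a : Fin k → (Fin 2 →₀ ℕ)) (d : Fin k → ℂ), vert (∑ i, monomial (a i) (d i) * ∏ j, g i j) ≤ V

/-- (skeleton) Aligned peeling with constants `(C, c)`. -/
def AlignedPeeling (C c : ℕ) : Prop :=
  ∀ (k ℓ t V : ℕ) (g : Fin k → Fin ℓ → MvPolynomial (Fin 2) ℂ) (p : Fin k → MvPolynomial (Fin 2) ℂ),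
    (∀ i j, (g i j).support.card ≤ t) → (∀ i, (p i).support.card ≤ t) → AlignedBound g V →
      vert (∑ i, p i * ∏ j, g i j) ≤ C * V + (k * t + 2) ^ c

/-- (skeleton) Level zero: a sum of `k` monomials has at most `k` vertices. -/
theorem vert_sum_monomial_le (k : ℕ) (a : Fin k → (Fin 2 →₀ ℕ)) (d : Fin k → ℂ) :
    vert (∑ i, monomial (a i) (d i)) ≤ k := by
  classical
  calc vert (∑ i, monomial (a i) (d i)) ≤ (∑ i, monomial (a i) (d i)).support.card := vert_le_card_support _
    _ ≤ (Finset.univ.biUnion fun i : Fin k => (monomial (a i) (d i)).support).card :=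
        Finset.card_le_card MvPolynomial.support_sum
    _ ≤ ∑ i : Fin k, (monomial (a i) (d i)).support.card := Finset.card_biUnion_le
    _ ≤ ∑ _i : Fin k, 1 := Finset.sum_le_sum fun i _ =>
        (Finset.card_le_card (support_monomial_subset)).trans (by simp)
    _ = k := by simp

/-- (skeleton) The level-`0` aligned bound. -/
theorem alignedBound_zero (k : ℕ) (g : Fin k → Fin 0 → MvPolynomial (Fin 2) ℂ) : AlignedBound g k := by
  intro a d
  simpa using vert_sum_monomial_le k a d

/-- (skeleton) Composition. -/
theorem NewtonTauWeak_of (h₁ : ∃ C c : ℕ, AlignedPeeling C c)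
    (h₂ : ∀ C c : ℕ, AlignedPeeling C c → SpsBound (C + 2) (c + 1)) :
    Summit.ValiantsHypothesis.ValiantsHypothesis.Theses.NewtonUnitEquations.NewtonTauWeak := by
  obtain ⟨C, c, h⟩ := h₁
  exact ⟨C + 2, c + 1, fun k m t f hf => h₂ C c h k m t f hf⟩

/-! ### The proof of `stub_peelInduction` -/

/-- The budget recursion `B 0 = k`, `B (ℓ+1) = C · B ℓ + (k t + 2)^c`. -/
def budget (C c k t : ℕ) : ℕ → ℕ
  | 0 => k
  | ℓ + 1 => C * budget C c k t ℓ + (k * t + 2) ^ c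

@[simp] theorem budget_zero (C c k t : ℕ) : budget C c k t 0 = k := rfl

@[simp] theorem budget_succ (C c k t ℓ : ℕ) : budget C c k t (ℓ + 1) = C * budget C c k t ℓ + (k * t + 2) ^ c := rfl

/-- Closed-form majorant of the budget. -/
theorem budget_le (C c k t : ℕ) : ∀ ℓ, budget C c k t ℓ ≤ (C + 1) ^ ℓ * (k + ℓ * (k * t + 2) ^ c)
  | 0 => by simp
  | ℓ + 1 => by
      have ih := budget_le C c k t ℓ
      have hC : C ≤ (C + 1) := Nat.le_succ C
      have h1 : 1 ≤ (C + 1) ^ (ℓ + 1) := Nat.one_le_pow _ _ (Nat.succ_pos _)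
      rw [budget_succ]
      calc C * budget C c k t ℓ + (k * t + 2) ^ c
          ≤ (C + 1) * ((C + 1) ^ ℓ * (k + ℓ * (k * t + 2) ^ c)) + (C + 1) ^ (ℓ + 1) * (k * t + 2) ^ c :=
            add_le_add (Nat.mul_le_mul hC ih) (Nat.le_mul_of_pos_left _ (by positivity))
        _ = (C + 1) ^ (ℓ + 1) * (k + (ℓ + 1) * (k * t + 2) ^ c) := by ring

/-- Sparsity of a monomial multiple: `#supp (monomial a d * q) ≤ #supp q`. -/
theorem card_support_monomial_mul_le (a : Fin 2 →₀ ℕ) (d : ℂ) (q : MvPolynomial (Fin 2) ℂ) :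
    (monomial a d * q).support.card ≤ q.support.card := by
  classical
  calc (monomial a d * q).support.card ≤ ((monomial a d).support + q.support).card :=
        Finset.card_le_card (MvPolynomial.support_mul _ _)
    _ ≤ (monomial a d).support.card * q.support.card := Finset.card_add_le
    _ ≤ 1 * q.support.card := Nat.mul_le_mul_right _ ((Finset.card_le_card support_monomial_subset).trans (by simp))
    _ = q.support.card := one_mul _

/-- THE PEEL INDUCTION at fixed `(k, t)`: every `t`-sparse family of `ℓ` factors satisfies the aligned bound `budget ℓ`. -/
theorem alignedBound_budget {C c : ℕ} (hAP : AlignedPeeling C c) (k t : ℕ) :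
    ∀ (ℓ : ℕ) (g : Fin k → Fin ℓ → MvPolynomial (Fin 2) ℂ), (∀ i j, (g i j).support.card ≤ t) →
      AlignedBound g (budget C c k t ℓ)
  | 0, g, _ => by simpa using alignedBound_zero k g
  | ℓ + 1, g, hg => by
      intro a d
      -- split off the last factor and absorb the monomial into it
      set g' : Fin k → Fin ℓ → MvPolynomial (Fin 2) ℂ := fun i j => g i (Fin.castSucc j) with hg'
      set p : Fin k → MvPolynomial (Fin 2) ℂ := fun i => monomial (a i) (d i) * g i (Fin.last ℓ) with hp
      have hrew : (∑ i, monomial (a i) (d i) * ∏ j, g i j) = ∑ i, p i * ∏ j, g' i j := by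
        refine Finset.sum_congr rfl fun i _ => ?_
        rw [Fin.prod_univ_castSucc]
        simp only [hg', hp]
        ring
      have hgs : ∀ i j, (g' i j).support.card ≤ t := fun i j => hg i _
      have hps : ∀ i, (p i).support.card ≤ t := fun i =>
        (card_support_monomial_mul_le _ _ _).trans (hg i _)
      have hIH : AlignedBound g' (budget C c k t ℓ) := alignedBound_budget hAP k t ℓ g' hgs
      rw [hrew, budget_succ]
      exact hAP k ℓ t (budget C c k t ℓ) g' p hgs hps hIH

/-- **`stub_peelInduction`, proved.**  Aligned peeling with constants `(C, c)` gives the crux's bound with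
`(a, b) = (C + 2, c + 1)`. -/
theorem peelInduction (C c : ℕ) (hAP : AlignedPeeling C c) : SpsBound (C + 2) (c + 1) := by
  intro k m t f hf
  -- `t = 0`: every factor vanishes; the sum is a constant (`m = 0`) or `0`
  rcases Nat.eq_zero_or_pos t with rfl | htpos
  · have hf0 : ∀ i j, f i j = 0 := fun i j => by
      have h0 := hf i j
      rwa [Nat.le_zero, Finset.card_eq_zero, MvPolynomial.support_eq_empty] at h0
    have hsub : (∑ i, ∏ j, f i j).support ⊆ {0} := by
      classical
      refine MvPolynomial.support_sum.trans (Finset.biUnion_subset.mpr fun i _ => ?_)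
      rcases Nat.eq_zero_or_pos m with rfl | hmpos
      · simp
      · have hz : ∏ j, f i j = 0 := Finset.prod_eq_zero (Finset.mem_univ ⟨0, hmpos⟩) (hf0 i _)
        simp [hz]
    calc vert (∑ i, ∏ j, f i j) ≤ (∑ i, ∏ j, f i j).support.card := vert_le_card_support _
      _ ≤ ({0} : Finset (Fin 2 →₀ ℕ)).card := Finset.card_le_card hsub
      _ ≤ 2 ^ ((C + 2) * m) * (k * 0 + 2) ^ (c + 1) := by
          have h1 : 1 ≤ 2 ^ ((C + 2) * m) := Nat.one_le_two_pow
          have h2 : 1 ≤ (k * 0 + 2) ^ (c + 1) := Nat.one_le_pow _ _ (by omega)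
          simpa using Nat.mul_le_mul h1 h2
  -- `t ≥ 1`: the peel induction with `a i = 0`, `d i = 1`
  have hal := alignedBound_budget hAP k t m f hf (fun _ => 0) (fun _ => 1)
  have hone : (∑ i, monomial (0 : Fin 2 →₀ ℕ) (1 : ℂ) * ∏ j, f i j) = ∑ i, ∏ j, f i j := by
    refine Finset.sum_congr rfl fun i _ => ?_
    rw [monomial_zero', C_1, one_mul]
  rw [hone] at hal
  refine hal.trans ((budget_le C c k t m).trans ?_)
  -- arithmetic: `(C+1)^m (k + m (kt+2)^c) ≤ 2^{(C+2) m} (kt+2)^{c+1}`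
  have hkt1 : 1 ≤ k * t + 2 := by omega
  have hk : k ≤ k * t + 2 := by nlinarith
  have hC1 : (C + 1) ^ m ≤ 2 ^ ((C + 1) * m) := by
    rw [pow_mul]; exact Nat.pow_le_pow_left (Nat.lt_two_pow_self).le _
  have hm2 : m + 1 ≤ 2 ^ m := Nat.lt_two_pow_self
  have hsum : k + m * (k * t + 2) ^ c ≤ 2 ^ m * (k * t + 2) ^ (c + 1) := by
    have h1 : 1 ≤ (k * t + 2) ^ c := Nat.one_le_pow _ _ hkt1
    have hA : k ≤ (k * t + 2) * (k * t + 2) ^ c := hk.trans (Nat.le_mul_of_pos_right _ (by positivity))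
    have hB : m * (k * t + 2) ^ c ≤ m * ((k * t + 2) * (k * t + 2) ^ c) :=
      Nat.mul_le_mul_left _ (Nat.le_mul_of_pos_left _ (by omega))
    calc k + m * (k * t + 2) ^ c ≤ (k * t + 2) * (k * t + 2) ^ c + m * ((k * t + 2) * (k * t + 2) ^ c) :=
          add_le_add hA hB
      _ = (m + 1) * (k * t + 2) ^ (c + 1) := by ring
      _ ≤ 2 ^ m * (k * t + 2) ^ (c + 1) := Nat.mul_le_mul_right _ hm2
  calc (C + 1) ^ m * (k + m * (k * t + 2) ^ c) ≤ 2 ^ ((C + 1) * m) * (2 ^ m * (k * t + 2) ^ (c + 1)) :=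
        Nat.mul_le_mul hC1 hsum
    _ = 2 ^ ((C + 2) * m) * (k * t + 2) ^ (c + 1) := by
        rw [← mul_assoc, ← pow_add]; congr 2; ring

/-- The registered stub, by name and signature. -/
theorem stub_peelInduction_proved : ∀ C c : ℕ, AlignedPeeling C c → SpsBound (C + 2) (c + 1) := peelInduction

/-- Hence the line closes the crux modulo `stub_alignedPeeling` ALONE. -/
theorem newtonTauWeak_of_alignedPeeling (h : ∃ C c : ℕ, AlignedPeeling C c) :
    Summit.ValiantsHypothesis.ValiantsHypothesis.Theses.NewtonUnitEquations.NewtonTauWeak :=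
  NewtonTauWeak_of h stub_peelInduction_proved

end

end Summit.ValiantsHypothesis.ValiantsHypothesis.Cruxes.NewtonTauWeak.AlignedPeeling
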